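import Mathlib
import HarnessLib
import Summits.AtomisticToContinuum.FouriersLaw.Theses.JunctionLocality
import Summits.AtomisticToContinuum.FouriersLaw.Theorems.BondHeatUncertaintyLinearResponseFTURSteadyHeatRatesHelper2
import Summits.AtomisticToContinuum.FouriersLaw.Theorems.JunctionLocalitySuperadditiveResistanceStubBypassBoundAux2

/-!
# Kubo link of line `ForecastSensitivitySketch`, helper IV: two cutoff-free tools for the MIXING-FREE route
(stub `stub_kuboLink`, crux stmt-AtomisticToContinuum-11749)

The mixing-free route to the finite-volume Kubo formula tests the weak stationarity of the NESS
`μ_δ = μ_{L,T+δ/2,T−δ/2}` against the equilibrium forward field `g` itself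
(`L_δ g = −k_0 + (γδ/2)(∂²_{p_0} g − ∂²_{p_{L−1}} g)`) and passes to `δ → 0` by the weak continuity of
the family; it needs `∫ L f dμ = 0` for NON-compactly-supported `f` with EXPONENTIAL weights and a
cutoff-free Gaussian integration by parts under `μ_T`.  This file proves both, for the pinned chain
`pinnedChain ω₂ lam β γ` (`ω₂ > 0`, `lam, β, γ ≥ 0`), `N ≥ 1`:

* `pinnedChain_integral_generator_eq_zero_of_expGrowth` — if a finite measure `μ` kills `L_{T_L,T_R} φ` for
  every `φ ∈ C_c^∞` (`T_L, T_R ≥ 0`) and integrates `e^{ϑ'H}`, then `∫ L f dμ = 0` for every smooth `f`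
  with `|f|, |L f|, |∂_{p_0} f|, |∂_{p_{N−1}} f| ≤ C e^{ϑH}`, `0 ≤ ϑ < ϑ'` (the twin of the landed
  polynomial-weight `pinnedChain_integral_generator_eq_zero_of_growth`: test on `f χ(H/R)`, `R = n + 1`,
  `L(fχ_R) = Lf` on `{H < R}`, `|L(fχ_R)| ≤ K e^{ϑH}(1 + H) ≤ K' e^{ϑ'H}` uniformly in `R ≥ 1`, dominated
  convergence);
* `pinnedChain_integral_partialP_gibbsMeasure` — `∫ ∂_{p_j} F dμ_T = T⁻¹ ∫ F p_j dμ_T` for `F` with a line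
  derivative along `(0, e_j)`, under the three integrability conditions (Mathlib's integration by parts for
  integrable products; no support condition), and `pinnedChain_integral_partialP_partialP_gibbsMeasure` —
  hence `∫ ∂²_{p_j} g dμ_T = T⁻² ∫ g (p_j² − T) dμ_T` for differentiable `g` with `g, ∂_{p_j} g ∈ L²(μ_T)` and
  `∂²_{p_j} g ∈ L¹(μ_T)` (with the landed gradient form `integral_mul_sq_sub_gibbsMeasure`).

References: Bonetto–Lebowitz–Rey-Bellet 2000 §5 (weak steady states); folklore (Gaussian IBP).
-/

noncomputable section

open MeasureTheory Filter Topology Set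
open scoped ContDiff NNReal ENNReal
open Literature.MathematicalPhysics.KineticTheory
open Literature.MathematicalPhysics.KineticTheory.HeatConduction
open Summit.AtomisticToContinuum.FouriersLaw.Theorems.SubdiffusiveBondHeat
open Summit.AtomisticToContinuum.FouriersLaw.Theorems.LinearResponseFTUR
open Summit.AtomisticToContinuum.FouriersLaw.Cruxes.SuperadditiveResistance.FloatingProbeBypassLaplacian

namespace Summit.AtomisticToContinuum.FouriersLaw.Cruxes.ConductanceLowerBound.ForecastSensitivity

variable {N : ℕ}

/-! ## Weak stationarity tested on exponentially bounded observables -/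

/-- `(1 + t) e^{ϑ t} ≤ (e^{ε}/ε) e^{(ϑ + ε) t}` for `t ≥ 0`, `ε > 0`. [folklore] -/
theorem one_add_mul_exp_le {ε : ℝ} (hε : 0 < ε) (ϑ : ℝ) {t : ℝ} (ht : 0 ≤ t) :
    (1 + t) * Real.exp (ϑ * t) ≤ (Real.exp ε / ε) * Real.exp ((ϑ + ε) * t) := by
  have h := one_add_pow_le_mul_exp 1 hε ht
  simp only [pow_one, Nat.factorial_one, Nat.cast_one] at h
  rw [show (ϑ + ε) * t = ϑ * t + ε * t by ring, Real.exp_add]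
  calc (1 + t) * Real.exp (ϑ * t) ≤ (1 / ε * Real.exp ε * Real.exp (ε * t)) * Real.exp (ϑ * t) :=
        mul_le_mul_of_nonneg_right h (Real.exp_pos _).le
    _ = Real.exp ε / ε * (Real.exp (ϑ * t) * Real.exp (ε * t)) := by ring

/-- **Weak stationarity for exponentially bounded observables.** For the pinned chain (`ω₂ > 0`,
`lam, β, γ ≥ 0`, `N ≥ 1`, `T_L, T_R ≥ 0`) and a finite measure `μ` with `∫ L φ dμ = 0` for all `φ ∈ C_c^∞` and
`e^{ϑ'H} ∈ L¹(μ)`: every smooth `f` with `|f|`, `|L f|`, `|∂_{p_0} f|`, `|∂_{p_{N−1}} f| ≤ C e^{ϑH}` (`ϑ < ϑ'`) has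
`∫ L f dμ = 0`. Proof: test on `f χ(H/R)`, `R = n + 1`; `L(fχ_R) = Lf` on `{H < R}` and
`|L(fχ_R)| ≤ K e^{ϑH}(1 + H)` uniformly in `R ≥ 1` (`generator_mul_cutoff`, `generator_comp_hamiltonian_closed`,
`carreDuChamp_hamiltonian`, `abs_three_terms_le` of the `LinearResponseFTUR` helpers); dominated convergence. -/
theorem pinnedChain_integral_generator_eq_zero_of_expGrowth {ω₂ lam β γ : ℝ} (hω : 0 < ω₂) (hl : 0 ≤ lam)
    (hβ : 0 ≤ β) (hγ : 0 ≤ γ) (hN : 0 < N) {T_L T_R : ℝ} (hTL : 0 ≤ T_L) (hTR : 0 ≤ T_R)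
    (μ : Measure (PhaseSpace N)) [IsFiniteMeasure μ]
    (hweak : ∀ g : PhaseSpace N → ℝ, ContDiff ℝ ((⊤ : ℕ∞) : WithTop ℕ∞) g → HasCompactSupport g →
      ∫ x, (pinnedChain ω₂ lam β γ).generator N T_L T_R g x ∂μ = 0)
    {ϑ ϑ' : ℝ} (hϑϑ' : ϑ < ϑ')
    (hexp : Integrable (fun x => Real.exp (ϑ' * (pinnedChain ω₂ lam β γ).hamiltonian N x)) μ)
    {f : PhaseSpace N → ℝ} {C : ℝ} (hf : ContDiff ℝ ((⊤ : ℕ∞) : WithTop ℕ∞) f)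
    (hfb : ∀ x, |f x| ≤ C * Real.exp (ϑ * (pinnedChain ω₂ lam β γ).hamiltonian N x))
    (hLb : ∀ x, |(pinnedChain ω₂ lam β γ).generator N T_L T_R f x| ≤
      C * Real.exp (ϑ * (pinnedChain ω₂ lam β γ).hamiltonian N x))
    (hP0 : ∀ x, |partialP ⟨0, hN⟩ f x| ≤ C * Real.exp (ϑ * (pinnedChain ω₂ lam β γ).hamiltonian N x))
    (hP1 : ∀ x, |partialP ⟨N - 1, Nat.sub_lt hN one_pos⟩ f x| ≤
      C * Real.exp (ϑ * (pinnedChain ω₂ lam β γ).hamiltonian N x)) :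
    ∫ x, (pinnedChain ω₂ lam β γ).generator N T_L T_R f x ∂μ = 0 := by
  -- adapted from `pinnedChain_integral_generator_eq_zero_of_growth` (…LinearResponseFTURSteadyHeatRatesHelper2)
  have hN1 : N - 1 < N := Nat.sub_lt hN one_pos
  have hU : ContDiff ℝ ∞ (pinnedChain ω₂ lam β γ).U := pinnedChain_contDiff_U ω₂ lam β γ
  have hV : ContDiff ℝ ∞ (pinnedChain ω₂ lam β γ).V := pinnedChain_contDiff_V ω₂ lam β γ
  have hU1 : ContDiff ℝ 1 (pinnedChain ω₂ lam β γ).U := pinnedChain_contDiff_U ω₂ lam β γ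
  have hV1 : ContDiff ℝ 1 (pinnedChain ω₂ lam β γ).V := pinnedChain_contDiff_V ω₂ lam β γ
  have hHs : ContDiff ℝ ∞ ((pinnedChain ω₂ lam β γ).hamiltonian N) :=
    (pinnedChain ω₂ lam β γ).contDiff_hamiltonian hU hV N
  have hH2 : ContDiff ℝ 2 ((pinnedChain ω₂ lam β γ).hamiltonian N) := hHs.of_le (by norm_cast)
  have hHd : Differentiable ℝ ((pinnedChain ω₂ lam β γ).hamiltonian N) :=
    hH2.differentiable (by norm_num)
  have hf2 : ContDiff ℝ 2 f := hf.of_le (by norm_cast)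
  have hfd : Differentiable ℝ f := hf2.differentiable (by norm_num)
  have hconf := pinnedChain_isConfining hω hl hβ hγ
  have hH0 : ∀ x, 0 ≤ (pinnedChain ω₂ lam β γ).hamiltonian N x := fun x =>
    pinnedChain_hamiltonian_nonneg hω.le hl hβ γ N x
  have hPγ : (pinnedChain ω₂ lam β γ).γ = γ := rfl
  have hγL : 0 ≤ (pinnedChain ω₂ lam β γ).γ * T_L := by rw [hPγ]; positivity
  have hγR : 0 ≤ (pinnedChain ω₂ lam β γ).γ * T_R := by rw [hPγ]; positivity
  obtain ⟨M₁, hM₁0, hM₁⟩ := exists_bound_deriv_smoothCutoff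
  obtain ⟨M₂, hM₂0, hM₂⟩ := exists_bound_deriv_deriv_smoothCutoff
  -- the weight `a = e^{ϑH} > 0`
  set E : PhaseSpace N → ℝ := fun x => Real.exp (ϑ * (pinnedChain ω₂ lam β γ).hamiltonian N x) with hE
  have hE0 : ∀ x, 0 < E x := fun x => Real.exp_pos _
  have hC0 : 0 ≤ C := by
    have h1 := hfb 0
    rcases lt_or_ge C 0 with h | h
    · have := mul_neg_of_neg_of_pos h (hE0 0)
      linarith [abs_nonneg (f 0)]
    · exact h
  -- elementary energy bounds on the momenta
  have hp2 : ∀ (x : PhaseSpace N) (i : Fin N), x.2 i ^ 2 ≤ 2 * (pinnedChain ω₂ lam β γ).hamiltonian N x := by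
    intro x i
    have h1 := (pinnedChain ω₂ lam β γ).site_le_hamiltonian hconf.U_nonneg hconf.V_nonneg N x i
    have h2 := hconf.U_nonneg (x.1 i)
    linarith
  have hp1 : ∀ (x : PhaseSpace N) (i : Fin N), |x.2 i| ≤ 1 + (pinnedChain ω₂ lam β γ).hamiltonian N x := by
    intro x i
    have h1 := abs_le_half_add_sq_half (x.2 i)
    have h2 := hp2 x i
    linarith
  -- the key pointwise formula for `L(f χ(H/R))`
  have key : ∀ (R : ℝ) (x : PhaseSpace N),
      (pinnedChain ω₂ lam β γ).generator N T_L T_R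
          (fun y => f y * smoothCutoff ((pinnedChain ω₂ lam β γ).hamiltonian N y / R)) x =
        smoothCutoff ((pinnedChain ω₂ lam β γ).hamiltonian N x / R) *
            (pinnedChain ω₂ lam β γ).generator N T_L T_R f x +
          f x * ((pinnedChain ω₂ lam β γ).γ *
            ((T_L * (deriv (deriv smoothCutoff) ((pinnedChain ω₂ lam β γ).hamiltonian N x / R) / R ^ 2 *
                  x.2 ⟨0, hN⟩ ^ 2 +
                deriv smoothCutoff ((pinnedChain ω₂ lam β γ).hamiltonian N x / R) / R) -
              deriv smoothCutoff ((pinnedChain ω₂ lam β γ).hamiltonian N x / R) / R * x.2 ⟨0, hN⟩ ^ 2) +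
            (T_R * (deriv (deriv smoothCutoff) ((pinnedChain ω₂ lam β γ).hamiltonian N x / R) / R ^ 2 *
                  x.2 ⟨N - 1, hN1⟩ ^ 2 +
                deriv smoothCutoff ((pinnedChain ω₂ lam β γ).hamiltonian N x / R) / R) -
              deriv smoothCutoff ((pinnedChain ω₂ lam β γ).hamiltonian N x / R) / R *
                x.2 ⟨N - 1, hN1⟩ ^ 2))) +
          deriv smoothCutoff ((pinnedChain ω₂ lam β γ).hamiltonian N x / R) / R *
            (Real.sqrt (2 * (pinnedChain ω₂ lam β γ).γ * T_L) ^ 2 * (x.2 ⟨0, hN⟩ * partialP ⟨0, hN⟩ f x) +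
              Real.sqrt (2 * (pinnedChain ω₂ lam β γ).γ * T_R) ^ 2 *
                (x.2 ⟨N - 1, hN1⟩ * partialP ⟨N - 1, hN1⟩ f x)) := by
    intro R x
    rw [generator_mul_cutoff _ hN hγL hγR hH2 hf2 R x,
      generator_comp_hamiltonian_closed _ hN hHd (hasDerivAt_scaled_smoothCutoff R)
        (hasDerivAt_deriv_scaled_smoothCutoff R) T_L T_R x,
      carreDuChamp_hamiltonian _ hN hHd hfd T_L T_R x]
  -- far from the cut-off the truncation is invisible
  have key_far : ∀ (R : ℝ) (x : PhaseSpace N), 0 < R → (pinnedChain ω₂ lam β γ).hamiltonian N x < R →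
      (pinnedChain ω₂ lam β γ).generator N T_L T_R
          (fun y => f y * smoothCutoff ((pinnedChain ω₂ lam β γ).hamiltonian N y / R)) x =
        (pinnedChain ω₂ lam β γ).generator N T_L T_R f x := by
    intro R x hR hx
    obtain ⟨h1, h2, h3⟩ := smoothCutoff_div_of_lt hR hx
    rw [key R x, h1, h2, h3]
    ring
  -- the uniform bound for `R ≥ 1`
  set K₁ : ℝ := γ * ((T_L + T_R) * (2 * M₂ + M₁) + 4 * M₁) with hK₁
  set G : ℝ := Real.sqrt (2 * (pinnedChain ω₂ lam β γ).γ * T_L) ^ 2 +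
    Real.sqrt (2 * (pinnedChain ω₂ lam β γ).γ * T_R) ^ 2 with hG
  set K : ℝ := C + C * K₁ + M₁ * G * C with hK
  have key_bd : ∀ (R : ℝ) (x : PhaseSpace N), 1 ≤ R →
      |(pinnedChain ω₂ lam β γ).generator N T_L T_R
          (fun y => f y * smoothCutoff ((pinnedChain ω₂ lam β γ).hamiltonian N y / R)) x| ≤
        K * (E x * (1 + (pinnedChain ω₂ lam β γ).hamiltonian N x)) := by
    intro R x hR
    rw [key R x]
    have hR0 : 0 < R := by linarith
    have hh := hH0 x
    have hF' : |deriv smoothCutoff ((pinnedChain ω₂ lam β γ).hamiltonian N x / R) / R| ≤ M₁ := by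
      rw [abs_div, abs_of_pos hR0]
      exact (div_le_self (abs_nonneg _) hR).trans (hM₁ _)
    have hF'' : |deriv (deriv smoothCutoff) ((pinnedChain ω₂ lam β γ).hamiltonian N x / R) / R ^ 2| ≤ M₂ := by
      rw [abs_div, abs_of_pos (by positivity : (0:ℝ) < R ^ 2)]
      exact (div_le_self (abs_nonneg _) (by nlinarith)).trans (hM₂ _)
    have hbath : ∀ (T : ℝ), 0 ≤ T → ∀ (p : ℝ), p ^ 2 ≤ 2 * (pinnedChain ω₂ lam β γ).hamiltonian N x →
        |T * (deriv (deriv smoothCutoff) ((pinnedChain ω₂ lam β γ).hamiltonian N x / R) / R ^ 2 * p ^ 2 +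
            deriv smoothCutoff ((pinnedChain ω₂ lam β γ).hamiltonian N x / R) / R) -
          deriv smoothCutoff ((pinnedChain ω₂ lam β γ).hamiltonian N x / R) / R * p ^ 2| ≤
          T * (M₂ * (2 * (pinnedChain ω₂ lam β γ).hamiltonian N x) + M₁) +
            M₁ * (2 * (pinnedChain ω₂ lam β γ).hamiltonian N x) := by
      intro T hT p hp
      set a := deriv (deriv smoothCutoff) ((pinnedChain ω₂ lam β γ).hamiltonian N x / R) / R ^ 2 with ha
      set b := deriv smoothCutoff ((pinnedChain ω₂ lam β γ).hamiltonian N x / R) / R with hb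
      have hp0 : 0 ≤ p ^ 2 := sq_nonneg p
      calc |T * (a * p ^ 2 + b) - b * p ^ 2| ≤ |T * (a * p ^ 2 + b)| + |b * p ^ 2| := abs_sub _ _
        _ = T * |a * p ^ 2 + b| + |b| * p ^ 2 := by
            rw [abs_mul, abs_mul, abs_of_nonneg hT, abs_of_nonneg hp0]
        _ ≤ T * (|a| * p ^ 2 + |b|) + |b| * p ^ 2 := by
            gcongr
            calc |a * p ^ 2 + b| ≤ |a * p ^ 2| + |b| := abs_add_le _ _
              _ = |a| * p ^ 2 + |b| := by rw [abs_mul, abs_of_nonneg hp0]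
        _ ≤ T * (M₂ * (2 * (pinnedChain ω₂ lam β γ).hamiltonian N x) + M₁) +
              M₁ * (2 * (pinnedChain ω₂ lam β γ).hamiltonian N x) := by
            gcongr
    have hmid : |(pinnedChain ω₂ lam β γ).γ *
        ((T_L * (deriv (deriv smoothCutoff) ((pinnedChain ω₂ lam β γ).hamiltonian N x / R) / R ^ 2 *
              x.2 ⟨0, hN⟩ ^ 2 +
            deriv smoothCutoff ((pinnedChain ω₂ lam β γ).hamiltonian N x / R) / R) -
          deriv smoothCutoff ((pinnedChain ω₂ lam β γ).hamiltonian N x / R) / R * x.2 ⟨0, hN⟩ ^ 2) +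
        (T_R * (deriv (deriv smoothCutoff) ((pinnedChain ω₂ lam β γ).hamiltonian N x / R) / R ^ 2 *
              x.2 ⟨N - 1, hN1⟩ ^ 2 +
            deriv smoothCutoff ((pinnedChain ω₂ lam β γ).hamiltonian N x / R) / R) -
          deriv smoothCutoff ((pinnedChain ω₂ lam β γ).hamiltonian N x / R) / R * x.2 ⟨N - 1, hN1⟩ ^ 2))| ≤
        K₁ * (1 + (pinnedChain ω₂ lam β γ).hamiltonian N x) := by
      have hA := hbath T_L hTL (x.2 ⟨0, hN⟩) (hp2 x _)
      have hB := hbath T_R hTR (x.2 ⟨N - 1, hN1⟩) (hp2 x _)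
      rw [abs_mul, hPγ, abs_of_nonneg hγ, hK₁]
      have hsum := (abs_add_le _ _).trans (add_le_add hA hB)
      have hT : 0 ≤ T_L + T_R := add_nonneg hTL hTR
      calc γ * _ ≤ γ * (T_L * (M₂ * (2 * (pinnedChain ω₂ lam β γ).hamiltonian N x) + M₁) +
            M₁ * (2 * (pinnedChain ω₂ lam β γ).hamiltonian N x) +
            (T_R * (M₂ * (2 * (pinnedChain ω₂ lam β γ).hamiltonian N x) + M₁) +
              M₁ * (2 * (pinnedChain ω₂ lam β γ).hamiltonian N x))) :=
            mul_le_mul_of_nonneg_left hsum hγ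
        _ ≤ γ * ((T_L + T_R) * (2 * M₂ + M₁) + 4 * M₁) * (1 + (pinnedChain ω₂ lam β γ).hamiltonian N x) := by
            have e1 : γ * (T_L * (M₂ * (2 * (pinnedChain ω₂ lam β γ).hamiltonian N x) + M₁) +
                M₁ * (2 * (pinnedChain ω₂ lam β γ).hamiltonian N x) +
                (T_R * (M₂ * (2 * (pinnedChain ω₂ lam β γ).hamiltonian N x) + M₁) +
                  M₁ * (2 * (pinnedChain ω₂ lam β γ).hamiltonian N x))) =
                γ * ((T_L + T_R) * (2 * M₂ * (pinnedChain ω₂ lam β γ).hamiltonian N x + M₁) +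
                  4 * M₁ * (pinnedChain ω₂ lam β γ).hamiltonian N x) := by ring
            rw [e1]
            have hXY : (T_L + T_R) * (2 * M₂ * (pinnedChain ω₂ lam β γ).hamiltonian N x + M₁) +
                4 * M₁ * (pinnedChain ω₂ lam β γ).hamiltonian N x ≤
                ((T_L + T_R) * (2 * M₂ + M₁) + 4 * M₁) * (1 + (pinnedChain ω₂ lam β γ).hamiltonian N x) := by
              nlinarith [mul_nonneg hT hM₂0, mul_nonneg (mul_nonneg hT hM₁0) hh, hM₁0, hh]
            calc γ * ((T_L + T_R) * (2 * M₂ * (pinnedChain ω₂ lam β γ).hamiltonian N x + M₁) +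
                  4 * M₁ * (pinnedChain ω₂ lam β γ).hamiltonian N x)
                ≤ γ * (((T_L + T_R) * (2 * M₂ + M₁) + 4 * M₁) *
                    (1 + (pinnedChain ω₂ lam β γ).hamiltonian N x)) := mul_le_mul_of_nonneg_left hXY hγ
              _ = _ := by ring
    have hΓ : |Real.sqrt (2 * (pinnedChain ω₂ lam β γ).γ * T_L) ^ 2 * (x.2 ⟨0, hN⟩ * partialP ⟨0, hN⟩ f x) +
          Real.sqrt (2 * (pinnedChain ω₂ lam β γ).γ * T_R) ^ 2 *
            (x.2 ⟨N - 1, hN1⟩ * partialP ⟨N - 1, hN1⟩ f x)| ≤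
        G * (C * E x) * (1 + (pinnedChain ω₂ lam β γ).hamiltonian N x) := by
      have hone : ∀ (c : ℝ) (i : Fin N), |partialP i f x| ≤ C * E x →
          |c ^ 2 * (x.2 i * partialP i f x)| ≤
            c ^ 2 * (C * E x) * (1 + (pinnedChain ω₂ lam β γ).hamiltonian N x) := by
        intro c i h2
        rw [abs_mul, abs_mul, abs_of_nonneg (sq_nonneg c)]
        have h1 := hp1 x i
        calc c ^ 2 * (|x.2 i| * |partialP i f x|) ≤ c ^ 2 * ((1 + (pinnedChain ω₂ lam β γ).hamiltonian N x) *
              (C * E x)) := by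
              refine mul_le_mul_of_nonneg_left ?_ (sq_nonneg c)
              exact mul_le_mul h1 h2 (abs_nonneg _) (by linarith)
          _ = _ := by ring
      refine (abs_add_le _ _).trans ((add_le_add (hone _ _ (hP0 x)) (hone _ _ (hP1 x))).trans_eq ?_)
      rw [hG]; ring
    have := abs_three_terms_le (abs_smoothCutoff_le_one ((pinnedChain ω₂ lam β γ).hamiltonian N x / R))
      (hLb x) (hfb x) hmid hF' hΓ hC0 (hE0 x).le hh
    rw [hK]
    exact this
  -- dominated convergence along `R = n + 1`
  have hcont : ∀ n : ℕ, Continuous ((pinnedChain ω₂ lam β γ).generator N T_L T_R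
      (fun y => f y * smoothCutoff ((pinnedChain ω₂ lam β γ).hamiltonian N y / ((n : ℝ) + 1)))) := by
    intro n
    refine (pinnedChain ω₂ lam β γ).continuous_generator hU1 hV1 N T_L T_R (hf2.mul ?_)
    exact (contDiff_smoothCutoff (n := 2)).comp (hH2.div_const _)
  have hsmooth : ∀ n : ℕ, ContDiff ℝ ∞
      (fun y => f y * smoothCutoff ((pinnedChain ω₂ lam β γ).hamiltonian N y / ((n : ℝ) + 1))) := fun n =>
    hf.mul ((contDiff_smoothCutoff (n := ⊤)).comp (hHs.div_const _))
  have hsupp : ∀ n : ℕ, HasCompactSupport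
      (fun y => f y * smoothCutoff ((pinnedChain ω₂ lam β γ).hamiltonian N y / ((n : ℝ) + 1))) := by
    intro n
    refine HasCompactSupport.intro
      (pinnedChain_isCompact_setOf_hamiltonian_le hω hl hβ γ N (2 * ((n : ℝ) + 1))) fun x hx => ?_
    have hx' : 2 ≤ (pinnedChain ω₂ lam β γ).hamiltonian N x / ((n : ℝ) + 1) := by
      rw [le_div_iff₀ (by positivity)]
      simp only [mem_setOf_eq, not_le] at hx
      linarith
    simp [smoothCutoff_of_two_le hx']
  have hzero : ∀ n : ℕ, ∫ x, (pinnedChain ω₂ lam β γ).generator N T_L T_R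
      (fun y => f y * smoothCutoff ((pinnedChain ω₂ lam β γ).hamiltonian N y / ((n : ℝ) + 1))) x ∂μ = 0 :=
    fun n => hweak _ (hsmooth n) (hsupp n)
  -- the majorant `K e^{ϑH}(1 + H) ≤ K (e^ε/ε) e^{ϑ'H}`, `ε = ϑ' − ϑ`
  have hε : 0 < ϑ' - ϑ := by linarith
  have hmaj : ∀ x, K * (E x * (1 + (pinnedChain ω₂ lam β γ).hamiltonian N x)) ≤
      K * (Real.exp (ϑ' - ϑ) / (ϑ' - ϑ)) * Real.exp (ϑ' * (pinnedChain ω₂ lam β γ).hamiltonian N x) := by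
    intro x
    have hK₁0 : 0 ≤ K₁ := by rw [hK₁]; positivity
    have hG0 : 0 ≤ G := by rw [hG]; positivity
    have hK0 : 0 ≤ K := by rw [hK]; positivity
    have h1 := one_add_mul_exp_le hε ϑ (hH0 x)
    rw [show ϑ + (ϑ' - ϑ) = ϑ' by ring] at h1
    calc K * (E x * (1 + (pinnedChain ω₂ lam β γ).hamiltonian N x))
        = K * ((1 + (pinnedChain ω₂ lam β γ).hamiltonian N x) * E x) := by ring
      _ ≤ K * ((Real.exp (ϑ' - ϑ) / (ϑ' - ϑ)) *
          Real.exp (ϑ' * (pinnedChain ω₂ lam β γ).hamiltonian N x)) := mul_le_mul_of_nonneg_left h1 hK0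
      _ = _ := by ring
  have hbound_int : Integrable (fun x => K * (Real.exp (ϑ' - ϑ) / (ϑ' - ϑ)) *
      Real.exp (ϑ' * (pinnedChain ω₂ lam β γ).hamiltonian N x)) μ := hexp.const_mul _
  have hlim := tendsto_integral_of_dominated_convergence
    (fun x => K * (Real.exp (ϑ' - ϑ) / (ϑ' - ϑ)) * Real.exp (ϑ' * (pinnedChain ω₂ lam β γ).hamiltonian N x))
    (fun n => (hcont n).aestronglyMeasurable) hbound_int
    (fun n => Eventually.of_forall fun x => by
      rw [Real.norm_eq_abs]
      exact (key_bd _ x (by simp)).trans (hmaj x))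
    (Eventually.of_forall fun x => by
      refine tendsto_const_nhds.congr' ?_
      refine Filter.eventually_atTop.2 ⟨⌈(pinnedChain ω₂ lam β γ).hamiltonian N x⌉₊, fun n hn => ?_⟩
      refine (key_far _ x (by positivity) ?_).symm
      have h1 := Nat.le_ceil ((pinnedChain ω₂ lam β γ).hamiltonian N x)
      have h2 : (⌈(pinnedChain ω₂ lam β γ).hamiltonian N x⌉₊ : ℝ) ≤ n := by exact_mod_cast hn
      linarith)
  simp only [hzero] at hlim
  exact (tendsto_nhds_unique hlim tendsto_const_nhds).symm ▸ rfl

/-! ## Cutoff-free Gaussian integration by parts under `μ_T` -/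

section GaussianIBP

variable {ω₂ lam β : ℝ} (hω : 0 < ω₂) (hl : 0 ≤ lam) (hβ : 0 ≤ β) (γ : ℝ) (L : ℕ) {T : ℝ} (hT : 0 < T)
include hω hl hβ hT

/-- **`∫ ∂_{p_j} F dμ_T = T⁻¹ ∫ F p_j dμ_T`** for the Gibbs measure of the pinned chain (`T > 0`) and any `F`
with a line derivative `F'` along `(0, e_j)` such that `F, F', F·p_j ∈ L¹(μ_T)` (`∂_{p_j} e^{−H/T} = −(p_j/T) e^{−H/T}`;
Mathlib's integration by parts for integrable products, no support condition). [folklore] -/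
theorem pinnedChain_integral_lineDeriv_gibbsMeasure (j : Fin L) {F F' : PhaseSpace L → ℝ}
    (hF : ∀ x, HasLineDerivAt ℝ F (F' x) x ((0, Pi.single j 1) : PhaseSpace L))
    (h0 : Integrable F ((pinnedChain ω₂ lam β γ).gibbsMeasure L T))
    (h1 : Integrable F' ((pinnedChain ω₂ lam β γ).gibbsMeasure L T))
    (h2 : Integrable (fun x => F x * x.2 j) ((pinnedChain ω₂ lam β γ).gibbsMeasure L T)) :
    ∫ x, F' x ∂((pinnedChain ω₂ lam β γ).gibbsMeasure L T) =
      T⁻¹ * ∫ x, F x * x.2 j ∂((pinnedChain ω₂ lam β γ).gibbsMeasure L T) := by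
  haveI := isAddHaarMeasure_volume_phaseSpace L
  set P := pinnedChain ω₂ lam β γ with hP
  have i0 := integrable_mul_gibbsDensity_of_integrable hω hl hβ γ L hT h0
  have i1 := integrable_mul_gibbsDensity_of_integrable hω hl hβ γ L hT h1
  have i2 := integrable_mul_gibbsDensity_of_integrable hω hl hβ γ L hT h2
  have e := integral_bilinear_hasLineDerivAt_right_eq_neg_left_of_integrable
    (μ := (volume : Measure (PhaseSpace L))) (B := ContinuousLinearMap.mul ℝ ℝ)
    (f := F) (f' := F') (g := fun y : PhaseSpace L => P.gibbsDensity L T y)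
    (g' := fun x => -(x.2 j / T) * P.gibbsDensity L T x)
    (v := ((0, Pi.single j 1) : PhaseSpace L)) ?_ ?_ ?_ (fun x _ => hF x)
    (fun x _ => P.hasLineDerivAt_gibbsDensity (T := T) (P.hasLineDerivAt_hamiltonian_unitP L x j))
  · simp only [ContinuousLinearMap.mul_apply'] at e
    rw [P.integral_gibbsMeasure, P.integral_gibbsMeasure, ← mul_assoc, mul_comm T⁻¹, mul_assoc]
    congr 1
    have e1 : ∫ x, F x * (-(x.2 j / T) * P.gibbsDensity L T x) = -T⁻¹ * ∫ x, F x * x.2 j * P.gibbsDensity L T x := by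
      rw [← integral_const_mul]
      refine integral_congr_ae (ae_of_all _ fun x => ?_)
      simp only
      field_simp
    rw [e1] at e
    linarith
  · simpa only [ContinuousLinearMap.mul_apply'] using i1
  · simp only [ContinuousLinearMap.mul_apply']
    refine (i2.const_mul (-T⁻¹)).congr (ae_of_all _ fun x => ?_)
    simp only [hP]
    field_simp
  · simpa only [ContinuousLinearMap.mul_apply'] using i0

/-- **Two cutoff-free Gaussian integrations by parts**: for `g` differentiable with `g, ∂_{p_j} g ∈ L²(μ_T)`,
`∂_{p_j} g` differentiable along `(0,e_j)` with `∂²_{p_j} g ∈ L¹(μ_T)`: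
`∫ ∂²_{p_j} g dμ_T = T⁻² ∫ g (p_j² − T) dμ_T` (the `He₂` identity behind the mixing-free Kubo link). [folklore] -/
theorem pinnedChain_integral_partialP_partialP_gibbsMeasure (j : Fin L) {g : PhaseSpace L → ℝ}
    (hg : Differentiable ℝ g) (hdg : Differentiable ℝ (partialP j g))
    (hg2 : MemLp g 2 ((pinnedChain ω₂ lam β γ).gibbsMeasure L T))
    (hdg2 : MemLp (partialP j g) 2 ((pinnedChain ω₂ lam β γ).gibbsMeasure L T))
    (hddg : Integrable (partialP j (partialP j g)) ((pinnedChain ω₂ lam β γ).gibbsMeasure L T)) :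
    ∫ x, partialP j (partialP j g) x ∂((pinnedChain ω₂ lam β γ).gibbsMeasure L T) =
      T⁻¹ ^ 2 * ∫ x, g x * (x.2 j ^ 2 - T) ∂((pinnedChain ω₂ lam β γ).gibbsMeasure L T) := by
  haveI := pinnedChain_isProbabilityMeasure_gibbsMeasure hω hl hβ γ L hT
  have hp := pinnedChain_memLp_two_snd hω hl hβ γ L hT j
  have step1 := pinnedChain_integral_lineDeriv_gibbsMeasure hω hl hβ γ L hT j
    (fun x => hasLineDerivAt_partialP hdg j x) (hdg2.integrable one_le_two) hddg (hdg2.integrable_mul hp)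
  have step2 := integral_mul_sq_sub_gibbsMeasure hω hl hβ γ L hT j hg hg2 hdg2
  rw [step1, step2]
  field_simp

end GaussianIBP

/-! ## Registered sub-goal -/

/-- **Registered sub-goal `helper_kuboExpGrowthStationarity`** (wave-2 helper IV of stub `stub_kuboLink`, crux
stmt-AtomisticToContinuum-11749): weak stationarity of a finite measure with an exponential moment tested on
exponentially bounded smooth observables (`pinnedChain_integral_generator_eq_zero_of_expGrowth`, closed form). -/
theorem helper_kuboExpGrowthStationarity :
    ∀ {N : ℕ} {ω₂ lam β γ : ℝ}, 0 < ω₂ → 0 ≤ lam → 0 ≤ β → 0 ≤ γ → ∀ (hN : 0 < N) {T_L T_R : ℝ}, 0 ≤ T_L → 0 ≤ T_R → ∀ (μ : Measure (PhaseSpace N)) [IsFiniteMeasure μ], (∀ g : PhaseSpace N → ℝ, ContDiff ℝ ((⊤ : ℕ∞) : WithTop ℕ∞) g → HasCompactSupport g → ∫ x, (pinnedChain ω₂ lam β γ).generator N T_L T_R g x ∂μ = 0) → ∀ {ϑ ϑ' : ℝ}, ϑ < ϑ' → Integrable (fun x => Real.exp (ϑ' * (pinnedChain ω₂ lam β γ).hamiltonian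 N x)) μ → ∀ {f : PhaseSpace N → ℝ} {C : ℝ}, ContDiff ℝ ((⊤ : ℕ∞) : WithTop ℕ∞) f → (∀ x, |f x| ≤ C * Real.exp (ϑ * (pinnedChain ω₂ lam β γ).hamiltonian N x)) → (∀ x, |(pinnedChain ω₂ lam β γ).generator N T_L T_R f x| ≤ C * Real.exp (ϑ * (pinnedChain ω₂ lam β γ).hamiltonian N x)) → (∀ x, |partialP ⟨0, hN⟩ f x| ≤ C * Real.exp (ϑ * (pinnedChain ω₂ lam β γ).hamiltonian N x)) → (∀ x, |partialP ⟨N - 1, Nat.sub_lt hN one_pos⟩ f x| ≤ C * Real.exp (ϑ * (pinnedChain ω₂ lam β γ).hamiltonian N x)) → ∫ x, (pinnedChain ω₂ lam β γ).generator N T_L T_R f x ∂μ = 0 := by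
  intro N ω₂ lam β γ hω hl hβ hγ hN T_L T_R hTL hTR μ _ hweak ϑ ϑ' hϑϑ' hexp f C hf hfb hLb hP0 hP1
  exact pinnedChain_integral_generator_eq_zero_of_expGrowth hω hl hβ hγ hN hTL hTR μ hweak hϑϑ' hexp hf hfb hLb
    hP0 hP1

end Summit.AtomisticToContinuum.FouriersLaw.Cruxes.ConductanceLowerBound.ForecastSensitivity

end
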